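import Summits.QuantumFields.YangMills.Theorems.UnitScaleTiltProp7FrameCorrectedMinusMeanT3Rows
import Summits.QuantumFields.YangMills.Theorems.UnitScaleTiltProp7NestedMeanPoincare
import HarnessLib

/-!
# Route `UnitScaleTilt`, crux K1 child «MinimiserStabilityRegPr» (stmt-QuantumFields-19200), skeleton v10, stub `stub_existenceMinimalOrbit` (EX), route (α) —
# **(R2t, FILE B2) THE TRANSFER-SMALLNESS ROW `‖(𝓚_{A₁} − 𝓚₀)N‖_crs ≤ √2·δ_T·‖toL2S N‖` AT THE T³ MEMBER** — plan v2 row R2t = the input `hKT` of ★w5-20520 g7's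
# ✓`Prop7LandauTransversalityPairing.hS_of_rowsZ` ∕ `htest_of_rows` (✓p662623), in the coarse-`ℓ²` CURRENCY OF RECORD `‖m‖²_crs = c₀·η⁻³·Σ_y ‖m y‖_F²` (namer's word 19:40:04Z;
# LOCATE memo `pub/ym3-torus/ym3-torus-px6/LOCATE-R2t-px6g2.md`).

Cell `ym3-torus`, width seat `ym3-torus-px6` (gen 2).  THEOREMS ONLY (0 `def`, 0 `sorry`).  `--supports stmt-QuantumFields-19200 --as helper`, count-neutral.  YM₃ on T³ is a ladder
rung (R3), not the Clay problem; nothing here claims the stub, the crux, d = 4 or the mass gap.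

THE POINT.  `𝓚_{A₁}N(y) = N(x̂⁽ᵏ⁾y) − V(y)·ν_k(y)⁻¹` (✓p648189's letters, `V` ANY derivative of `frameAccU (K−n) U₀♭ ((U′♭)^{g_t})`, `ġ = N`), `𝓚₀N = ns_{K−n}` (any averaging sequence
of ✓`QTwS_gaugeDir_of_avgSeq`, = the derivative at `U′ = U₀` by ✓`hasDerivAt_frameAccU_of_avgSeq` + ✓`frameAccU_self`).  From ✓`frameResponse_norm_sub_avgSeq_le` with FILE B1's data:
**pointwise `‖𝓚_{A₁}N(y) − ns_{K−n}(y)‖ ≤ δ_T·RMS_{B^{K−n}(y)}(N)`** (§8 ★★★) for every DISPLAYED `δ_T ≥ 2(240L + 19560L³)(2e + 2700Lε₀)∕(L − 1)` (`hδT`; `3∕10⁴` by ✓`deltaT_le`,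
`3∕10⁶` by ✓`deltaT_le_tight` — the knit evaluates the letter under its own windows, namer's RESHAPE 20:13:56Z), hence in the currency of record (`η⁻³ = |B^{K−n}|`, Frobenius `≤ √2·`operator
on `M₂`) **`c₀η⁻³Σ_yΣ_{jk}|(𝓚_{A₁}N − ns_{K−n})(y)_{jk}|² ≤ 2·δ_T²·‖toL2S F K c₀ N‖²`**, `√(…) ≤ √2·δ_T·‖toL2S N‖` (ALL `N` — no smoothness, no loop row), the `η`-free BOUNDEDNESS
row `‖ns_{K−n}N‖_crs ≤ √2·‖toL2S N‖` (background only), and ON THE SECTOR `ns_{K−n} = 0` the `hKT`-shape `q(𝓚_{A₁}N) ≤ √2·δ_T·(‖toL2S N‖ + ‖D_{U₀}(toL2S N)‖)` — also in the (Y1) letters (§9).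

WHAT IS PROVED (sorry-free, no definition): ★★★`norm_frameResponse_sub_avgSeq_le_of_regPr`, `eta_inv_cube_mul_card_inv`, `crs_le_of_blockRMS`, `sqrt_crs_le_of_blockRMS`,
★★★`crs_frameResponse_sub_avgSeq_le_of_regPr`, ★★`crs_avgSeq_le_of_regPr`, ★★`sqrt_crs_frameResponse_le_of_regPr_of_avgSeq_eq_zero`; §9 (the (Y1) letters of the knit:
`Y := SiteL2K ℂ 3 (periodsT3 F n) c₁ W₂`, `c₁ = c₀η⁻³`, coarse fields read through ✓`siteShift (sites_eq F n K h)`) `normSq_toL2S_shift_eq`, ★★`norm_toL2S_shift_frameResponse_le_of_regPr_of_avgSeq_eq_zero`.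
INHABITABILITY: at `U′ = U₀` (`A₁ = 0`) every row of FILE B1 holds with the same constants and `V = N∘x̂ − ns` makes the left sides vanish.
HONEST SCOPE: the (hS) assembly (`Kop`, `q`, `Z`, the sector decision (H-Z)) is the knitter's; `hreg′` enters only through B1; constants crude (`√2`); nothing of print is asserted.

References: T. Bałaban, CMP 98 (1985) 17–51 [Balaban1985Averaging] ((18)–(19) p.21, (97) p.32, (161)–(163) p.42); CMP 99 (1985) 389–434 [Balaban1985BackgroundPropagators] ((3.11) p.392,
(3.19) p.393, (3.21)–(3.23) p.394); CMP 102 (1985) 277–309 [Balaban1985Variational] ((2) p.278, (45) p.285).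
-/

set_option autoImplicit false

noncomputable section

open scoped BigOperators Topology
open Filter NormedSpace Metric
open scoped Matrix.Norms.L2Operator

namespace Summit.QuantumFields.YangMills.Theorems.Prop7FrameCorrectedMinusMean

open Literature.MathematicalPhysics.QuantumFieldTheory.Balaban1983to89
open T4Continuum BlockAveraging ExpMeanLog MatrixLog
open B10Eq27TorusAxialLog (holT gaugeActT gaugeActT_apply transl unitsField toUField)
open B7Prop1Explicit (expUnit val_expUnit disp U1 mem_U1)
open B7TransferAnalyticMean (meanCLM meanCLM_apply)
open Summit.QuantumFields.YangMills.Theorems.Prop7SymAvgTwSym (tstairU tstairU_def vframeCovU coe_vframeCovU dbarCovIterU frameAccU frameAccU_succ frameAccU_zero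
  dbarCovIterU_eq_gaugeActT_frameAccU norm_tstairU_sub_one_le_geom_of_regPr norm_dbarCovIterU_rel_sub_one_le_geom_of_regPr pow_mul_eta_le_one pow_mul_eta_eq_one
  holT_mem_U1 emlIterU_bgUnits_mem_U1_of_regPr)
open Summit.QuantumFields.YangMills.Theorems.Prop7TowerClosenessOfRegPr (frameAccU_bgUnits_mem_specialUnitaryGroup_of_regPr bgUnits_eq_expUnit_mul)
open Summit.QuantumFields.YangMills.Theorems.Prop8Chart (emlIterU)
open B15DeterminingSets (embIter)
open B5Eq118OneStroke (iterBlockOf iterBlock mem_iterBlock iterBlock_zero sum_iterBlock_succ card_iterBlock)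
open T3ContinuumYM3Torus
open T3PrintedRegularMinimiser (RegPr)
open T3SectALandauChart (eta eta_pos bgUnits)
open B7Prop2SpecialUnitary (specialUnitaryUnits mem_specialUnitaryUnits specialUnitaryUnits_le_U1)

/-! ## §8 The R2t rows at the T³ member -/

section Main

open Summit.QuantumFields.YangMills.Theorems.Prop7SectET3HilbertLetters (W₂ toL2S DL2)
open Summit.QuantumFields.YangMills.Theorems.Prop7NestedMeanPoincare (normSq_toL2S_eq)
open Summit.QuantumFields.YangMills.Theorems.Prop7CovariantCoercivity (sum_norm_sq_le_mul_opNorm_sq)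

variable (F : T3Family) {n K : ℕ}

/-- ★★★ **R2t, POINTWISE AT THE T³ MEMBER: `‖𝓚_{A₁}N(y) − ns_{K−n}(y)‖ ≤ δ_T · RMS_{B^{K−n}(y)}(N)`** for every displayed `δ_T ≥ 2(240L + 19560L³)(2e + 2700Lε₀)∕(L − 1)`
(`δ_T := 3∕10⁴` by `deltaT_le` under the windows of record, `3∕10⁶` by `deltaT_le_tight` under `10¹¹L²e ≤ 1`, `10¹⁴L³ε₀ ≤ 1`).  For `U₀ ∈ 𝔘_k(ε₀)` (`10¹²L³ε₀ ≤ 1`), `U′ = e^{A₁}U₀ ∈ 𝔘_k(ε₀′)`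
(`10⁷L³ε₀′ ≤ 1`), `‖A₁‖ < e·η` (`10⁹L²e ≤ 1`), any gauge family `g_t` through `1` with site derivative `N`, any averaging sequence `ns` of `N` against `Ū₀♭` (the letters of
✓`QTwS_gaugeDir_of_avgSeq`, so `𝓚₀N = ns_{K−n}` by ✓`hasDerivAt_frameAccU_of_avgSeq`) and EVERY derivative letter `V` of the accumulated frames along `(U′♭)^{g_t}` at the top level
(✓`exists_frameCorrected_eq`'s letters): the frame-corrected value minus the nested covariant mean is bounded by `δ_T` times the block RMS of `N` — `η`-free, no smoothness of `N`, no loop row.  ✓`frameResponse_norm_sub_avgSeq_le` with §6's data, the block-RMS majorant (`S = L²`) and §7's `ε`. [cite: Balaban1985Averaging, (97) p.32, (82) p.30, (161)-(163) p.42; Balaban1985BackgroundPropagators, (3.19) p.393, (3.21) p.394; Balaban1985Variational, (2) p.278, (45) p.285] -/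
theorem norm_frameResponse_sub_avgSeq_le_of_regPr {ε₀ ε₀' e : ℝ} (hε₀ : 0 < ε₀) (he : 0 < e) (hWe : 10 ^ 9 * (F.L : ℝ) ^ 2 * e ≤ 1) (hWε : 10 ^ 12 * (F.L : ℝ) ^ 3 * ε₀ ≤ 1)
    (hε₀' : 0 < ε₀') (hε' : 10 ^ 7 * (F.L : ℝ) ^ 3 * ε₀' ≤ 1)
    (U₀ U' : GaugeField (F.P K) 0 (Matrix.specialUnitaryGroup (Fin 2) ℂ)) (hreg : RegPr F n K ε₀ U₀) (hreg' : RegPr F n K ε₀' U')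
    (A₁ : PBond (F.P K) 0 → Matrix (Fin 2) (Fin 2) ℂ) (hA₁ : ‖A₁‖ < e * eta F n K)
    (hU' : ∀ b, ((U' b : Matrix.specialUnitaryGroup (Fin 2) ℂ) : Matrix (Fin 2) (Fin 2) ℂ) = exp (A₁ b) * ((U₀ b : Matrix.specialUnitaryGroup (Fin 2) ℂ) : Matrix (Fin 2) (Fin 2) ℂ))
    {g : ℝ → Site (F.P K) 0 → (Matrix (Fin 2) (Fin 2) ℂ)ˣ} {N : Site (F.P K) 0 → Matrix (Fin 2) (Fin 2) ℂ} (hg0 : g 0 = fun _ => 1)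
    (hgd : ∀ x, HasDerivAt (fun t : ℝ => ((g t x : (Matrix (Fin 2) (Fin 2) ℂ)ˣ) : Matrix (Fin 2) (Fin 2) ℂ)) (N x) 0)
    (ns : (j : ℕ) → Site (F.P K) j → Matrix (Fin 2) (Fin 2) ℂ) (h0 : ns 0 = N)
    (hsucc : ∀ (j : ℕ) (y : Site (F.P K) (j + 1)), ns (j + 1) y = ns j (emb y) - meanCLM (Idx (F.P K)) (Matrix (Fin 2) (Fin 2) ℂ) fun i : Idx (F.P K) =>
        ns j (emb y) - ((holT (emlIterU j (bgUnits F K U₀)) (emb y) (stairWord i.2.1 (off i.1)) : (Matrix (Fin 2) (Fin 2) ℂ)ˣ) : Matrix (Fin 2) (Fin 2) ℂ) *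
          ns j (transl (emb y) (disp (stairWord i.2.1 (off i.1)))) * (((holT (emlIterU j (bgUnits F K U₀)) (emb y) (stairWord i.2.1 (off i.1)))⁻¹ : (Matrix (Fin 2) (Fin 2) ℂ)ˣ) : Matrix (Fin 2) (Fin 2) ℂ))
    {V : Site (F.P K) (K - n) → Matrix (Fin 2) (Fin 2) ℂ}
    (hV : ∀ x : Site (F.P K) (K - n), HasDerivAt (fun t : ℝ => ((frameAccU (K - n) (bgUnits F K U₀) (gaugeActT (g t) (bgUnits F K U')) x : (Matrix (Fin 2) (Fin 2) ℂ)ˣ) : Matrix (Fin 2) (Fin 2) ℂ)) (V x) 0)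
    {δT : ℝ} (hδT : 2 * (240 * (F.L : ℝ) + 19560 * (F.L : ℝ) ^ 3) * (2 * e + 2700 * (F.L : ℝ) * ε₀) / ((F.L : ℝ) - 1) ≤ δT)
    (y : Site (F.P K) (K - n)) :
    ‖(N (embIter (K - n) y) - V y * (((frameAccU (K - n) (bgUnits F K U₀) (bgUnits F K U') y)⁻¹ : (Matrix (Fin 2) (Fin 2) ℂ)ˣ) : Matrix (Fin 2) (Fin 2) ℂ)) - ns (K - n) y‖
      ≤ δT * Real.sqrt (((((F.P K).L : ℝ) ^ (F.P K).d) ^ (K - n))⁻¹ * ∑ x ∈ iterBlock (K - n) y, ‖N x‖ ^ 2) := by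
  obtain ⟨hτ, hν, hν', hν1, hν1', hw', hP, hP', hQ, hQ'⟩ := towerData_of_regPr F hε₀ he hWe hWε hε₀' hε' U₀ U' hreg hreg' A₁ hA₁ hU'
  obtain ⟨hε, hεle, hεsucc⟩ := epsSeq_rows F (n := n) (K := K) hε₀ he.le hWe hWε
  have hLL : ((F.P K).L : ℝ) = F.L := rfl
  have hd : (F.P K).d = 3 := T3Family.P_d F K
  have hL3 : 3 ≤ F.L := by obtain ⟨a, ha⟩ := F.hL.1; have := F.hL.2; omega
  have hL1 : (1 : ℝ) ≤ F.L := by exact_mod_cast (show 1 ≤ F.L by omega)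
  have hη : 0 < eta F n K := eta_pos F n K
  have hS : ((F.P K).L : ℝ) ^ (F.P K).d ≤ ((F.L : ℝ) ^ 2) ^ 2 := by
    rw [hLL, hd, ← pow_mul]; exact pow_le_pow_right₀ hL1 (by norm_num)
  have hmK : ∀ j, j < K - n → j + 1 ≤ (F.P K).m + (F.P K).K := fun j hj => by
    show j + 1 ≤ F.m + K; have := F.hm; omega
  -- `δτ_j ≤ 1∕24`
  have hδτ : ∀ j, j < K - n → 60 * (F.L : ℝ) * ((2 * e + 2700 * (F.L : ℝ) * ε₀) * ((F.L : ℝ) ^ j * eta F n K)) ≤ 1 / 24 := by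
    intro j hj
    have hX : (F.L : ℝ) ^ j * eta F n K ≤ 1 := pow_mul_eta_le_one F hj.le
    have hu : (F.L : ℝ) ^ 2 * e ≤ 1 / 10 ^ 9 := by rw [le_div_iff₀ (by positivity)]; linarith
    have hv : (F.L : ℝ) ^ 3 * ε₀ ≤ 1 / 10 ^ 12 := by rw [le_div_iff₀ (by positivity)]; linarith
    have h1 : (F.L : ℝ) * e ≤ (F.L : ℝ) ^ 2 * e := mul_le_mul_of_nonneg_right (le_self_pow₀ hL1 two_ne_zero) he.le
    have h2 : (F.L : ℝ) ^ 2 * ε₀ ≤ (F.L : ℝ) ^ 3 * ε₀ := mul_le_mul_of_nonneg_right (pow_le_pow_right₀ hL1 (by norm_num)) hε₀.le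
    calc 60 * (F.L : ℝ) * ((2 * e + 2700 * (F.L : ℝ) * ε₀) * ((F.L : ℝ) ^ j * eta F n K))
        ≤ 60 * (F.L : ℝ) * ((2 * e + 2700 * (F.L : ℝ) * ε₀) * 1) := by gcongr
      _ = 120 * ((F.L : ℝ) * e) + 162000 * ((F.L : ℝ) ^ 2 * ε₀) := by ring
      _ ≤ 1 / 24 := by linarith
  have hmain := frameResponse_norm_sub_avgSeq_le (bgUnits F K U₀) (bgUnits F K U') hg0 hgd ns h0 hsucc (K - n)
    (fun j => 60 * (F.L : ℝ) * ((2 * e + 2700 * (F.L : ℝ) * ε₀) * ((F.L : ℝ) ^ j * eta F n K)))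
    (fun j => 6 * (5 * (F.L : ℝ)) * ((2 * e + 2700 * (F.L : ℝ) * ε₀) * ((F.L : ℝ) ^ j * eta F n K)))
    (fun j => 2 * ∑ i ∈ Finset.range j, (240 * (F.L : ℝ) + 19560 * (F.L : ℝ) ^ 3) * ((2 * e + 2700 * (F.L : ℝ) * ε₀) * ((F.L : ℝ) ^ i * eta F n K)))
    (S := (F.L : ℝ) ^ 2) (by positivity) hδτ hτ hν hν' hν1 hν1' hw' hP hP' hQ hQ'
    (fun j z => Real.sqrt (((((F.P K).L : ℝ) ^ (F.P K).d) ^ j)⁻¹ * ∑ x ∈ iterBlock j z, ‖N x‖ ^ 2))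
    (fun j z => Real.sqrt_nonneg _) (fun x => (blockRMS_zero N x).symm.le)
    (fun j y' hj => mean_blockRMS_le (hmK j hj) N y')
    (fun j y' i hj => blockRMS_le_of_blockOf_eq N (by positivity) hS y' _ (Site.blockOf_blockSite (hmK j hj) y' i.1))
    (fun j y' hj => blockRMS_le_of_blockOf_eq N (by positivity) hS y' _ (Site.blockOf_emb (hmK j hj) y'))
    hε hεsucc le_rfl hV y
  exact hmain.trans (mul_le_mul_of_nonneg_right ((hεle _ le_rfl).trans hδT) (Real.sqrt_nonneg _))

/-- `η⁻³` is the number of finest sites per top block: `(eta F n K)⁻¹ ^ 3 · ((L^3)^{K−n})⁻¹ = 1`. [cite: Balaban1985BackgroundPropagators, (3.11) p.392] -/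
theorem eta_inv_cube_mul_card_inv : (eta F n K)⁻¹ ^ 3 * ((((F.P K).L : ℝ) ^ (F.P K).d) ^ (K - n))⁻¹ = 1 := by
  have hLL : ((F.P K).L : ℝ) = F.L := rfl
  have hd : (F.P K).d = 3 := T3Family.P_d F K
  have hL0 : (0 : ℝ) < F.L := by have := F.hL.2; exact_mod_cast (show 0 < F.L by omega)
  have hη : eta F n K = ((F.L : ℝ)⁻¹) ^ (K - n) := rfl
  have hinv : (F.L : ℝ)⁻¹ ^ (K - n) = ((F.L : ℝ) ^ (K - n))⁻¹ := inv_pow _ _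
  rw [hLL, hd, hη, hinv, inv_inv, ← pow_mul, ← pow_mul, mul_comm (K - n) 3, mul_inv_cancel₀ (pow_ne_zero _ hL0.ne')]

/-- from a pointwise block-RMS bound to the COARSE-`ℓ²` CURRENCY OF RECORD: if `‖m y‖ ≤ ε·RMS_{B^{K−n}(y)}(N)` at every top site then
**`c₀·η⁻³·Σ_y Σ_{jk} |m(y)_{jk}|² ≤ 2·ε²·‖toL2S F K c₀ N‖²`** (Frobenius `≤ √2·`operator on `M₂`, ✓`sum_norm_sq_le_mul_opNorm_sq`; `η⁻³ = |B^{K−n}|`; ✓`normSq_toL2S_eq`).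
[cite: Balaban1985BackgroundPropagators, (3.11) p.392; Balaban1985Averaging, (18)-(19) p.21] -/
theorem crs_le_of_blockRMS {c₀ : ℝ} [Fact (0 < c₀)] (N : Site (F.P K) 0 → Matrix (Fin 2) (Fin 2) ℂ) (m : Site (F.P K) (K - n) → Matrix (Fin 2) (Fin 2) ℂ) {ε : ℝ}
    (hm : ∀ y : Site (F.P K) (K - n), ‖m y‖ ≤ ε * Real.sqrt (((((F.P K).L : ℝ) ^ (F.P K).d) ^ (K - n))⁻¹ * ∑ x ∈ iterBlock (K - n) y, ‖N x‖ ^ 2)) :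
    c₀ * (eta F n K)⁻¹ ^ 3 * ∑ y : Site (F.P K) (K - n), ∑ j : Fin 2, ∑ k : Fin 2, ‖m y j k‖ ^ 2 ≤ 2 * ε ^ 2 * ‖toL2S F K c₀ N‖ ^ 2 := by
  have hc : 0 < c₀ := Fact.out
  have hη : 0 < eta F n K := eta_pos F n K
  have hsum := sum_normSq_le_of_blockRMS N m hm
  have hF : ∀ y, ∑ j : Fin 2, ∑ k : Fin 2, ‖m y j k‖ ^ 2 ≤ 2 * ‖m y‖ ^ 2 := fun y => by
    have := sum_norm_sq_le_mul_opNorm_sq (N := 2) (m y)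
    simpa using this
  have hop : ∑ x : Site (F.P K) 0, ‖N x‖ ^ 2 ≤ ∑ x : Site (F.P K) 0, ∑ j : Fin 2, ∑ k : Fin 2, ‖N x j k‖ ^ 2 :=
    Finset.sum_le_sum fun x _ => MatrixNorms.opNorm_sq_le_sum_norm_sq (N x)
  rw [normSq_toL2S_eq F (c₀ := c₀) N]
  calc c₀ * (eta F n K)⁻¹ ^ 3 * ∑ y : Site (F.P K) (K - n), ∑ j : Fin 2, ∑ k : Fin 2, ‖m y j k‖ ^ 2
      ≤ c₀ * (eta F n K)⁻¹ ^ 3 * ∑ y : Site (F.P K) (K - n), 2 * ‖m y‖ ^ 2 := by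
        refine mul_le_mul_of_nonneg_left (Finset.sum_le_sum fun y _ => hF y) (by positivity)
    _ = 2 * (c₀ * (eta F n K)⁻¹ ^ 3) * ∑ y : Site (F.P K) (K - n), ‖m y‖ ^ 2 := by rw [← Finset.mul_sum]; ring
    _ ≤ 2 * (c₀ * (eta F n K)⁻¹ ^ 3) * (ε ^ 2 * (((((F.P K).L : ℝ) ^ (F.P K).d) ^ (K - n))⁻¹ * ∑ x : Site (F.P K) 0, ‖N x‖ ^ 2)) :=
        mul_le_mul_of_nonneg_left hsum (by positivity)
    _ = 2 * ε ^ 2 * c₀ * ((eta F n K)⁻¹ ^ 3 * ((((F.P K).L : ℝ) ^ (F.P K).d) ^ (K - n))⁻¹) * ∑ x : Site (F.P K) 0, ‖N x‖ ^ 2 := by ring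
    _ = 2 * ε ^ 2 * c₀ * ∑ x : Site (F.P K) 0, ‖N x‖ ^ 2 := by rw [eta_inv_cube_mul_card_inv, mul_one]
    _ ≤ 2 * ε ^ 2 * c₀ * ∑ x : Site (F.P K) 0, ∑ j : Fin 2, ∑ k : Fin 2, ‖N x j k‖ ^ 2 := mul_le_mul_of_nonneg_left hop (by positivity)
    _ = 2 * ε ^ 2 * (c₀ * ∑ x : Site (F.P K) 0, ∑ j : Fin 2, ∑ k : Fin 2, ‖N x j k‖ ^ 2) := by ring

/-- the `Real.sqrt` form of `crs_le_of_blockRMS`: `q(m) ≤ √2·ε·‖toL2S N‖` (`q` = the currency of record of ✓`Prop7LandauTransversalityPairing.hS_of_rowsZ`). [cite: Balaban1985BackgroundPropagators, (3.11) p.392] -/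
theorem sqrt_crs_le_of_blockRMS {c₀ : ℝ} [Fact (0 < c₀)] (N : Site (F.P K) 0 → Matrix (Fin 2) (Fin 2) ℂ) (m : Site (F.P K) (K - n) → Matrix (Fin 2) (Fin 2) ℂ) {ε : ℝ} (hε : 0 ≤ ε)
    (hm : ∀ y : Site (F.P K) (K - n), ‖m y‖ ≤ ε * Real.sqrt (((((F.P K).L : ℝ) ^ (F.P K).d) ^ (K - n))⁻¹ * ∑ x ∈ iterBlock (K - n) y, ‖N x‖ ^ 2)) :
    Real.sqrt (c₀ * (eta F n K)⁻¹ ^ 3 * ∑ y : Site (F.P K) (K - n), ∑ j : Fin 2, ∑ k : Fin 2, ‖m y j k‖ ^ 2) ≤ Real.sqrt 2 * ε * ‖toL2S F K c₀ N‖ := by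
  have h := crs_le_of_blockRMS F (c₀ := c₀) N m hm
  have hrhs : 0 ≤ Real.sqrt 2 * ε * ‖toL2S F K c₀ N‖ := by positivity
  rw [← Real.sqrt_sq hrhs]
  refine Real.sqrt_le_sqrt (h.trans (le_of_eq ?_))
  rw [mul_pow, mul_pow, Real.sq_sqrt (by norm_num : (0 : ℝ) ≤ 2)]

/-- ★★★ **R2t IN THE COARSE-`ℓ²` CURRENCY OF RECORD (squared and `Real.sqrt` forms, ALL `N`)**: under the hypotheses of `norm_frameResponse_sub_avgSeq_le_of_regPr`,
**`c₀·η⁻³·Σ_y Σ_{jk} |(𝓚_{A₁}N − ns_{K−n})(y)_{jk}|² ≤ 2·δ_T²·‖toL2S F K c₀ N‖²`** and `√(…) ≤ √2·δ_T·‖toL2S F K c₀ N‖` (displayed letter `δ_T`, `hδT`) — the row `hKT` of ✓`hS_of_rowsZ` (`δ = √2·δ_T`) once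
`ns_{K−n} = 0` on the sector (`crs_frameResponse_le_of_regPr_of_avgSeq_eq_zero`). [cite: Balaban1985BackgroundPropagators, (3.11) p.392, (3.19) p.393, (3.21)-(3.23) p.394; Balaban1985Averaging, (97) p.32; Balaban1985Variational, (45) p.285] -/
theorem crs_frameResponse_sub_avgSeq_le_of_regPr {ε₀ ε₀' e : ℝ} (hε₀ : 0 < ε₀) (he : 0 < e) (hWe : 10 ^ 9 * (F.L : ℝ) ^ 2 * e ≤ 1) (hWε : 10 ^ 12 * (F.L : ℝ) ^ 3 * ε₀ ≤ 1)
    (hε₀' : 0 < ε₀') (hε' : 10 ^ 7 * (F.L : ℝ) ^ 3 * ε₀' ≤ 1)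
    (U₀ U' : GaugeField (F.P K) 0 (Matrix.specialUnitaryGroup (Fin 2) ℂ)) (hreg : RegPr F n K ε₀ U₀) (hreg' : RegPr F n K ε₀' U')
    (A₁ : PBond (F.P K) 0 → Matrix (Fin 2) (Fin 2) ℂ) (hA₁ : ‖A₁‖ < e * eta F n K)
    (hU' : ∀ b, ((U' b : Matrix.specialUnitaryGroup (Fin 2) ℂ) : Matrix (Fin 2) (Fin 2) ℂ) = exp (A₁ b) * ((U₀ b : Matrix.specialUnitaryGroup (Fin 2) ℂ) : Matrix (Fin 2) (Fin 2) ℂ))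
    {g : ℝ → Site (F.P K) 0 → (Matrix (Fin 2) (Fin 2) ℂ)ˣ} {N : Site (F.P K) 0 → Matrix (Fin 2) (Fin 2) ℂ} (hg0 : g 0 = fun _ => 1)
    (hgd : ∀ x, HasDerivAt (fun t : ℝ => ((g t x : (Matrix (Fin 2) (Fin 2) ℂ)ˣ) : Matrix (Fin 2) (Fin 2) ℂ)) (N x) 0)
    (ns : (j : ℕ) → Site (F.P K) j → Matrix (Fin 2) (Fin 2) ℂ) (h0 : ns 0 = N)
    (hsucc : ∀ (j : ℕ) (y : Site (F.P K) (j + 1)), ns (j + 1) y = ns j (emb y) - meanCLM (Idx (F.P K)) (Matrix (Fin 2) (Fin 2) ℂ) fun i : Idx (F.P K) =>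
        ns j (emb y) - ((holT (emlIterU j (bgUnits F K U₀)) (emb y) (stairWord i.2.1 (off i.1)) : (Matrix (Fin 2) (Fin 2) ℂ)ˣ) : Matrix (Fin 2) (Fin 2) ℂ) *
          ns j (transl (emb y) (disp (stairWord i.2.1 (off i.1)))) * (((holT (emlIterU j (bgUnits F K U₀)) (emb y) (stairWord i.2.1 (off i.1)))⁻¹ : (Matrix (Fin 2) (Fin 2) ℂ)ˣ) : Matrix (Fin 2) (Fin 2) ℂ))
    {V : Site (F.P K) (K - n) → Matrix (Fin 2) (Fin 2) ℂ}
    (hV : ∀ x : Site (F.P K) (K - n), HasDerivAt (fun t : ℝ => ((frameAccU (K - n) (bgUnits F K U₀) (gaugeActT (g t) (bgUnits F K U')) x : (Matrix (Fin 2) (Fin 2) ℂ)ˣ) : Matrix (Fin 2) (Fin 2) ℂ)) (V x) 0)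
    {δT : ℝ} (hδT : 2 * (240 * (F.L : ℝ) + 19560 * (F.L : ℝ) ^ 3) * (2 * e + 2700 * (F.L : ℝ) * ε₀) / ((F.L : ℝ) - 1) ≤ δT)
    {c₀ : ℝ} [Fact (0 < c₀)] :
    c₀ * (eta F n K)⁻¹ ^ 3 * ∑ y : Site (F.P K) (K - n), ∑ j : Fin 2, ∑ k : Fin 2,
        ‖((N (embIter (K - n) y) - V y * (((frameAccU (K - n) (bgUnits F K U₀) (bgUnits F K U') y)⁻¹ : (Matrix (Fin 2) (Fin 2) ℂ)ˣ) : Matrix (Fin 2) (Fin 2) ℂ)) - ns (K - n) y) j k‖ ^ 2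
        ≤ 2 * δT ^ 2 * ‖toL2S F K c₀ N‖ ^ 2 ∧
      Real.sqrt (c₀ * (eta F n K)⁻¹ ^ 3 * ∑ y : Site (F.P K) (K - n), ∑ j : Fin 2, ∑ k : Fin 2,
        ‖((N (embIter (K - n) y) - V y * (((frameAccU (K - n) (bgUnits F K U₀) (bgUnits F K U') y)⁻¹ : (Matrix (Fin 2) (Fin 2) ℂ)ˣ) : Matrix (Fin 2) (Fin 2) ℂ)) - ns (K - n) y) j k‖ ^ 2)
        ≤ Real.sqrt 2 * δT * ‖toL2S F K c₀ N‖ := by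
  have hpt := norm_frameResponse_sub_avgSeq_le_of_regPr F hε₀ he hWe hWε hε₀' hε' U₀ U' hreg hreg' A₁ hA₁ hU' hg0 hgd ns h0 hsucc hV hδT
  have hL3 : (3 : ℝ) ≤ F.L := by
    have hL3 : 3 ≤ F.L := by obtain ⟨a, ha⟩ := F.hL.1; have := F.hL.2; omega
    exact_mod_cast hL3
  have hL1 : (0 : ℝ) < (F.L : ℝ) - 1 := by linarith
  have hδT0 : 0 ≤ δT := le_trans (div_nonneg (by positivity) hL1.le) hδT
  exact ⟨crs_le_of_blockRMS F (c₀ := c₀) N _ hpt, sqrt_crs_le_of_blockRMS F (c₀ := c₀) N _ hδT0 hpt⟩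

/-- ★★ **THE `η`-FREE BOUNDEDNESS ROW: `‖ns_{K−n} N‖_crs ≤ √2·‖toL2S F K c₀ N‖`** (squared: `≤ 2‖toL2S N‖²`) — the nested covariant mean of `Ū₀♭` (any averaging sequence, background
`U₀ ∈ 𝔘_k(ε₀)` only) contracts the block RMS (§3 of `…Step` + the RMS majorant), and the block RMS sums to the fine `ℓ²` norm; the `√2` is Frobenius vs operator on `M₂`.  Hence
`‖𝓚_{A₁}N‖_crs ≤ √2·(1 + 3·10⁻⁴)·‖toL2S N‖` (with the ★★★ row), the input of ★w5-20520 g7's resolvent-smoothing transfer. [cite: Balaban1985Averaging, (97) p.32, (19) p.21; Balaban1985BackgroundPropagators, (3.11) p.392, (3.19) p.393] -/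
theorem crs_avgSeq_le_of_regPr {ε₀ : ℝ} (hε₀ : 0 < ε₀) (hε7 : 10 ^ 7 * (F.L : ℝ) ^ 3 * ε₀ ≤ 1)
    (U₀ : GaugeField (F.P K) 0 (Matrix.specialUnitaryGroup (Fin 2) ℂ)) (hreg : RegPr F n K ε₀ U₀)
    {N : Site (F.P K) 0 → Matrix (Fin 2) (Fin 2) ℂ} (ns : (j : ℕ) → Site (F.P K) j → Matrix (Fin 2) (Fin 2) ℂ) (h0 : ns 0 = N)
    (hsucc : ∀ (j : ℕ) (y : Site (F.P K) (j + 1)), ns (j + 1) y = ns j (emb y) - meanCLM (Idx (F.P K)) (Matrix (Fin 2) (Fin 2) ℂ) fun i : Idx (F.P K) =>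
        ns j (emb y) - ((holT (emlIterU j (bgUnits F K U₀)) (emb y) (stairWord i.2.1 (off i.1)) : (Matrix (Fin 2) (Fin 2) ℂ)ˣ) : Matrix (Fin 2) (Fin 2) ℂ) *
          ns j (transl (emb y) (disp (stairWord i.2.1 (off i.1)))) * (((holT (emlIterU j (bgUnits F K U₀)) (emb y) (stairWord i.2.1 (off i.1)))⁻¹ : (Matrix (Fin 2) (Fin 2) ℂ)ˣ) : Matrix (Fin 2) (Fin 2) ℂ))
    {c₀ : ℝ} [Fact (0 < c₀)] :
    c₀ * (eta F n K)⁻¹ ^ 3 * ∑ y : Site (F.P K) (K - n), ∑ j : Fin 2, ∑ k : Fin 2, ‖ns (K - n) y j k‖ ^ 2 ≤ 2 * ‖toL2S F K c₀ N‖ ^ 2 ∧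
      Real.sqrt (c₀ * (eta F n K)⁻¹ ^ 3 * ∑ y : Site (F.P K) (K - n), ∑ j : Fin 2, ∑ k : Fin 2, ‖ns (K - n) y j k‖ ^ 2) ≤ Real.sqrt 2 * ‖toL2S F K c₀ N‖ := by
  have hmK : ∀ j, j < K - n → j + 1 ≤ (F.P K).m + (F.P K).K := fun j hj => by
    show j + 1 ≤ F.m + K; have := F.hm; omega
  have hQ1 : ∀ (j : ℕ), j < K - n → ∀ b : PBond (F.P K) j, emlIterU j (bgUnits F K U₀) b ∈ U1 (Matrix (Fin 2) (Fin 2) ℂ) := fun j hj b =>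
    emlIterU_bgUnits_mem_U1_of_regPr F hε₀ hε7 hreg hj.le b
  have hpt : ∀ y : Site (F.P K) (K - n), ‖ns (K - n) y‖ ≤ 1 * Real.sqrt (((((F.P K).L : ℝ) ^ (F.P K).d) ^ (K - n))⁻¹ * ∑ x ∈ iterBlock (K - n) y, ‖N x‖ ^ 2) := by
    intro y
    rw [one_mul]
    exact norm_avgSeq_le_majorant (bgUnits F K U₀) (K - n) ns h0 hsucc (fun j y i hj => (mem_U1.1 (holT_mem_U1 (hQ1 j hj) _ _)).1)
      (fun j y i hj => (mem_U1.1 (holT_mem_U1 (hQ1 j hj) _ _)).2)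
      (fun j z => Real.sqrt (((((F.P K).L : ℝ) ^ (F.P K).d) ^ j)⁻¹ * ∑ x ∈ iterBlock j z, ‖N x‖ ^ 2)) (fun x => (blockRMS_zero N x).symm.le)
      (fun j y' hj => mean_blockRMS_le (hmK j hj) N y') (K - n) le_rfl y
  refine ⟨?_, ?_⟩
  · have h := crs_le_of_blockRMS F (c₀ := c₀) N _ hpt; rw [one_pow, mul_one] at h; exact h
  · have h := sqrt_crs_le_of_blockRMS F (c₀ := c₀) N _ zero_le_one hpt; rw [mul_one] at h; exact h

/-- ★★ **R2t ON THE SECTOR «the nested mean ends at `0`» — THE ROW `hKT` OF ✓`Prop7LandauTransversalityPairing.hS_of_rowsZ` VERBATIM IN SIZE** (`Kop N` the displayed coarse field,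
`q` the `Real.sqrt` of the currency of record, `δ := √2·δ_T`): if `ns_{K−n} = 0` then `q(𝓚_{A₁}N) ≤ √2·δ_T·(‖toL2S N‖ + ‖D_{U₀}(toL2S N)‖)`.
[cite: Balaban1985BackgroundPropagators, (3.19) p.393, (3.21)-(3.23) p.394; Balaban1985Variational, (45) p.285] -/
theorem sqrt_crs_frameResponse_le_of_regPr_of_avgSeq_eq_zero {ε₀ ε₀' e : ℝ} (hε₀ : 0 < ε₀) (he : 0 < e) (hWe : 10 ^ 9 * (F.L : ℝ) ^ 2 * e ≤ 1)
    (hWε : 10 ^ 12 * (F.L : ℝ) ^ 3 * ε₀ ≤ 1) (hε₀' : 0 < ε₀') (hε' : 10 ^ 7 * (F.L : ℝ) ^ 3 * ε₀' ≤ 1)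
    (U₀ U' : GaugeField (F.P K) 0 (Matrix.specialUnitaryGroup (Fin 2) ℂ)) (hreg : RegPr F n K ε₀ U₀) (hreg' : RegPr F n K ε₀' U')
    (A₁ : PBond (F.P K) 0 → Matrix (Fin 2) (Fin 2) ℂ) (hA₁ : ‖A₁‖ < e * eta F n K)
    (hU' : ∀ b, ((U' b : Matrix.specialUnitaryGroup (Fin 2) ℂ) : Matrix (Fin 2) (Fin 2) ℂ) = exp (A₁ b) * ((U₀ b : Matrix.specialUnitaryGroup (Fin 2) ℂ) : Matrix (Fin 2) (Fin 2) ℂ))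
    {g : ℝ → Site (F.P K) 0 → (Matrix (Fin 2) (Fin 2) ℂ)ˣ} {N : Site (F.P K) 0 → Matrix (Fin 2) (Fin 2) ℂ} (hg0 : g 0 = fun _ => 1)
    (hgd : ∀ x, HasDerivAt (fun t : ℝ => ((g t x : (Matrix (Fin 2) (Fin 2) ℂ)ˣ) : Matrix (Fin 2) (Fin 2) ℂ)) (N x) 0)
    (ns : (j : ℕ) → Site (F.P K) j → Matrix (Fin 2) (Fin 2) ℂ) (h0 : ns 0 = N)
    (hsucc : ∀ (j : ℕ) (y : Site (F.P K) (j + 1)), ns (j + 1) y = ns j (emb y) - meanCLM (Idx (F.P K)) (Matrix (Fin 2) (Fin 2) ℂ) fun i : Idx (F.P K) =>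
        ns j (emb y) - ((holT (emlIterU j (bgUnits F K U₀)) (emb y) (stairWord i.2.1 (off i.1)) : (Matrix (Fin 2) (Fin 2) ℂ)ˣ) : Matrix (Fin 2) (Fin 2) ℂ) *
          ns j (transl (emb y) (disp (stairWord i.2.1 (off i.1)))) * (((holT (emlIterU j (bgUnits F K U₀)) (emb y) (stairWord i.2.1 (off i.1)))⁻¹ : (Matrix (Fin 2) (Fin 2) ℂ)ˣ) : Matrix (Fin 2) (Fin 2) ℂ))
    (hZ : ∀ y : Site (F.P K) (K - n), ns (K - n) y = 0)
    {V : Site (F.P K) (K - n) → Matrix (Fin 2) (Fin 2) ℂ}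
    (hV : ∀ x : Site (F.P K) (K - n), HasDerivAt (fun t : ℝ => ((frameAccU (K - n) (bgUnits F K U₀) (gaugeActT (g t) (bgUnits F K U')) x : (Matrix (Fin 2) (Fin 2) ℂ)ˣ) : Matrix (Fin 2) (Fin 2) ℂ)) (V x) 0)
    {δT : ℝ} (hδT : 2 * (240 * (F.L : ℝ) + 19560 * (F.L : ℝ) ^ 3) * (2 * e + 2700 * (F.L : ℝ) * ε₀) / ((F.L : ℝ) - 1) ≤ δT)
    {c₀ : ℝ} [Fact (0 < c₀)] :
    Real.sqrt (c₀ * (eta F n K)⁻¹ ^ 3 * ∑ y : Site (F.P K) (K - n), ∑ j : Fin 2, ∑ k : Fin 2,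
        ‖(N (embIter (K - n) y) - V y * (((frameAccU (K - n) (bgUnits F K U₀) (bgUnits F K U') y)⁻¹ : (Matrix (Fin 2) (Fin 2) ℂ)ˣ) : Matrix (Fin 2) (Fin 2) ℂ)) j k‖ ^ 2)
      ≤ Real.sqrt 2 * δT * (‖toL2S F K c₀ N‖ + ‖DL2 F n K c₀ U₀ (toL2S F K c₀ N)‖) := by
  have h := (crs_frameResponse_sub_avgSeq_le_of_regPr F hε₀ he hWe hWε hε₀' hε' U₀ U' hreg hreg' A₁ hA₁ hU' hg0 hgd ns h0 hsucc hV hδT (c₀ := c₀)).2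
  have hL3 : (3 : ℝ) ≤ F.L := by
    have hL3 : 3 ≤ F.L := by obtain ⟨a, ha⟩ := F.hL.1; have := F.hL.2; omega
    exact_mod_cast hL3
  have hL1 : (0 : ℝ) < (F.L : ℝ) - 1 := by linarith
  have hδT0 : 0 ≤ δT := le_trans (div_nonneg (by positivity) hL1.le) hδT
  simp only [hZ, sub_zero] at h
  exact h.trans (mul_le_mul_of_nonneg_left (le_add_of_nonneg_right (norm_nonneg _)) (by positivity))

end Main


/-! ## §9 The (Y1) reading: the currency of record as the level-`n` Hilbert norm of the shifted coarse field -/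

section Y1

open Summit.QuantumFields.YangMills.Theorems.Prop7SectET3HilbertLetters (W₂ toL2S DL2)
open Summit.QuantumFields.YangMills.Theorems.Prop7NestedMeanPoincare (normSq_toL2S_eq)
open T3LevelShift (siteShift)
open T3PrintedRegularOrbits (sites_eq)

variable (F : T3Family) {n K : ℕ} (h : n ≤ K)

/-- **(Y1) THE CURRENCY OF RECORD IS A `toL2S` NORM AT LEVEL `n`**: for any weight `c₁` (the assembler takes `c₁ := c₀·η⁻³`, `haveI : Fact (0 < c₁)`), the coarse field `m` on
`Site (F.P K) (K − n)` read on `Site (F.P n) 0` through ✓`siteShift (sites_eq F n K h)` has `‖toL2S F n c₁ (m ∘ siteShift)‖² = c₁·Σ_y Σ_{jk} |m(y)_{jk}|²` (✓`normSq_toL2S_eq` at `K := n`,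
reindexed along the equivalence). [cite: Balaban1985BackgroundPropagators, (3.11) p.392; Balaban1987RG1, (0.1) p.251] -/
theorem normSq_toL2S_shift_eq {c₁ : ℝ} [Fact (0 < c₁)] (m : Site (F.P K) (K - n) → Matrix (Fin 2) (Fin 2) ℂ) :
    ‖toL2S F n c₁ (fun y' : Site (F.P n) 0 => m (siteShift (sites_eq F n K h) y'))‖ ^ 2
      = c₁ * ∑ y : Site (F.P K) (K - n), ∑ j : Fin 2, ∑ k : Fin 2, ‖m y j k‖ ^ 2 := by
  rw [normSq_toL2S_eq F (c₀ := c₁)]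
  congr 1
  exact Fintype.sum_equiv (siteShift (sites_eq F n K h)) _ _ fun _ => rfl

/-- ★★ **R2t IN THE (Y1) LETTERS OF THE KNIT** (`Y := SiteL2K ℂ 3 (periodsT3 F n) c₁ W₂`, `Kop N := toL2S F n c₁ ((𝓚_{A₁}N) ∘ siteShift)`, `q := ‖·‖`, `c₁ = c₀·η⁻³`): on the sector
`ns_{K−n} = 0`, **`‖toL2S F n c₁ ((𝓚_{A₁}N) ∘ siteShift)‖ ≤ √2·δ_T·(‖toL2S F K c₀ N‖ + ‖D_{U₀}(toL2S F K c₀ N)‖)`** — ✓`hS_of_rowsZ`'s `hKT` with `δ := √2·δ_T`, by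
`sqrt_crs_frameResponse_le_of_regPr_of_avgSeq_eq_zero` and `normSq_toL2S_shift_eq`. [cite: Balaban1985BackgroundPropagators, (3.11) p.392, (3.19) p.393, (3.21)-(3.23) p.394; Balaban1985Variational, (45) p.285] -/
theorem norm_toL2S_shift_frameResponse_le_of_regPr_of_avgSeq_eq_zero {ε₀ ε₀' e : ℝ} (hε₀ : 0 < ε₀) (he : 0 < e) (hWe : 10 ^ 9 * (F.L : ℝ) ^ 2 * e ≤ 1)
    (hWε : 10 ^ 12 * (F.L : ℝ) ^ 3 * ε₀ ≤ 1) (hε₀' : 0 < ε₀') (hε' : 10 ^ 7 * (F.L : ℝ) ^ 3 * ε₀' ≤ 1)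
    (U₀ U' : GaugeField (F.P K) 0 (Matrix.specialUnitaryGroup (Fin 2) ℂ)) (hreg : RegPr F n K ε₀ U₀) (hreg' : RegPr F n K ε₀' U')
    (A₁ : PBond (F.P K) 0 → Matrix (Fin 2) (Fin 2) ℂ) (hA₁ : ‖A₁‖ < e * eta F n K)
    (hU' : ∀ b, ((U' b : Matrix.specialUnitaryGroup (Fin 2) ℂ) : Matrix (Fin 2) (Fin 2) ℂ) = exp (A₁ b) * ((U₀ b : Matrix.specialUnitaryGroup (Fin 2) ℂ) : Matrix (Fin 2) (Fin 2) ℂ))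
    {g : ℝ → Site (F.P K) 0 → (Matrix (Fin 2) (Fin 2) ℂ)ˣ} {N : Site (F.P K) 0 → Matrix (Fin 2) (Fin 2) ℂ} (hg0 : g 0 = fun _ => 1)
    (hgd : ∀ x, HasDerivAt (fun t : ℝ => ((g t x : (Matrix (Fin 2) (Fin 2) ℂ)ˣ) : Matrix (Fin 2) (Fin 2) ℂ)) (N x) 0)
    (ns : (j : ℕ) → Site (F.P K) j → Matrix (Fin 2) (Fin 2) ℂ) (h0 : ns 0 = N)
    (hsucc : ∀ (j : ℕ) (y : Site (F.P K) (j + 1)), ns (j + 1) y = ns j (emb y) - meanCLM (Idx (F.P K)) (Matrix (Fin 2) (Fin 2) ℂ) fun i : Idx (F.P K) =>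
        ns j (emb y) - ((holT (emlIterU j (bgUnits F K U₀)) (emb y) (stairWord i.2.1 (off i.1)) : (Matrix (Fin 2) (Fin 2) ℂ)ˣ) : Matrix (Fin 2) (Fin 2) ℂ) *
          ns j (transl (emb y) (disp (stairWord i.2.1 (off i.1)))) * (((holT (emlIterU j (bgUnits F K U₀)) (emb y) (stairWord i.2.1 (off i.1)))⁻¹ : (Matrix (Fin 2) (Fin 2) ℂ)ˣ) : Matrix (Fin 2) (Fin 2) ℂ))
    (hZ : ∀ y : Site (F.P K) (K - n), ns (K - n) y = 0)
    {V : Site (F.P K) (K - n) → Matrix (Fin 2) (Fin 2) ℂ}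
    (hV : ∀ x : Site (F.P K) (K - n), HasDerivAt (fun t : ℝ => ((frameAccU (K - n) (bgUnits F K U₀) (gaugeActT (g t) (bgUnits F K U')) x : (Matrix (Fin 2) (Fin 2) ℂ)ˣ) : Matrix (Fin 2) (Fin 2) ℂ)) (V x) 0)
    {δT : ℝ} (hδT : 2 * (240 * (F.L : ℝ) + 19560 * (F.L : ℝ) ^ 3) * (2 * e + 2700 * (F.L : ℝ) * ε₀) / ((F.L : ℝ) - 1) ≤ δT)
    {c₀ : ℝ} [Fact (0 < c₀)] {c₁ : ℝ} [Fact (0 < c₁)] (hc₁ : c₁ = c₀ * (eta F n K)⁻¹ ^ 3) :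
    ‖toL2S F n c₁ (fun y' : Site (F.P n) 0 =>
        N (embIter (K - n) (siteShift (sites_eq F n K h) y')) - V (siteShift (sites_eq F n K h) y') *
          (((frameAccU (K - n) (bgUnits F K U₀) (bgUnits F K U') (siteShift (sites_eq F n K h) y'))⁻¹ : (Matrix (Fin 2) (Fin 2) ℂ)ˣ) : Matrix (Fin 2) (Fin 2) ℂ))‖
      ≤ Real.sqrt 2 * δT * (‖toL2S F K c₀ N‖ + ‖DL2 F n K c₀ U₀ (toL2S F K c₀ N)‖) := by
  have hsq := normSq_toL2S_shift_eq F h (c₁ := c₁) (fun y : Site (F.P K) (K - n) =>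
    N (embIter (K - n) y) - V y * (((frameAccU (K - n) (bgUnits F K U₀) (bgUnits F K U') y)⁻¹ : (Matrix (Fin 2) (Fin 2) ℂ)ˣ) : Matrix (Fin 2) (Fin 2) ℂ))
  have hcrs := sqrt_crs_frameResponse_le_of_regPr_of_avgSeq_eq_zero F hε₀ he hWe hWε hε₀' hε' U₀ U' hreg hreg' A₁ hA₁ hU' hg0 hgd ns h0 hsucc hZ hV hδT (c₀ := c₀)
  rw [← hc₁, ← hsq, Real.sqrt_sq (norm_nonneg _)] at hcrs
  exact hcrs

end Y1

end Summit.QuantumFields.YangMills.Theorems.Prop7FrameCorrectedMinusMean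

end
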